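import Mathlib.GroupTheory.FreeGroup.NielsenSchreier
import Mathlib.GroupTheory.OrderOfElement
import Mathlib.Data.ZMod.Basic
import Literature.AnabelianGeometry.AbsoluteAnabelian.FreeProSigmaCompletionBridge
import Literature.AnabelianGeometry.SemiGraphs.ProSigmaCompletionRestrict
import Literature.AnabelianGeometry.SemiGraphs.ProSigmaCompletionQuotients
import Literature.AnabelianGeometry.Anabelioids.ProSigmaProofs
import Literature.GroupTheory.CombinatorialGroupTheory.PuncturedSurfaceGroupFree
import HarnessLib

/-!
# Pro-`Σ` completions of free groups — hence free pro-`Σ` groups of finite rank — are TORSION-FREE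

S. Mochizuki, *Topics in Absolute Anabelian Geometry I: Generalities* (2012) [AbsTopI] (lit key
`paper:url-11ac98ba15fc`), Lemma 4.5 (i) p. 54: "`X` is non-proper if and only if every torsion-free
pro-`Σ` open subgroup of `Δ` is free pro-`Σ`" — the typed predicate `CuspidalData.NonProperIffFree`
(FACT-LIST F-0208) and the cusp-detection data of Lemma 4.5 (iii)/(iv) quantify over "torsion-free
pro-`Σ` [characteristic] open subgroups `H ⊆ Δ`"; at the MODELS (`Δ` a pro-`Σ` completion of a free group
`Γ_{g,r}`, `r ≥ 1`) such `H` must be exhibited, which needs: **pro-`Σ` completions of free groups have no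
torsion**.  The tree holds the case `Σ = Primes` for Mathlib's `ProfiniteCompletion`
(`IsFreeGroup.eq_one_of_pow_eq_one_profiniteCompletion`, `CombinatorialGroupTheory/
FreeGroupCompletionTorsionFree.lean`); this PROOF-ONLY file (no definitions, no named facts) proves it
for the L3 interface `IsProSigmaCompletion Σ ι` (ANY set `Σ`) and transports it to the L4 predicate
`IsFreeProOn` through abc-iut-L4-t15's bridge:

* `IsProSigmaCompletion.eq_one_of_pow_eq_one_of_not_mem` — in a pro-`Σ` completion (of anything) an
  element killed by a prime `q ∉ Σ` is trivial;
* `IsProSigmaCompletion.eq_one_of_pow_eq_one_of_isFreeGroup` — **for `Γ` free (`IsFreeGroup`, any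
  rank) and `ι : Γ → P` a pro-`Σ` completion with `P` profinite, `z ^ m = 1`, `m > 0` ⇒ `z = 1`**;
  `…isOfFinOrder_iff_of_isFreeGroup`; the punctured-surface-group form
  `…eq_one_of_pow_eq_one_puncturedSurfaceGroup` (`Γ_{g,r}`, `r ≥ 1`, is free);
* `IsFreeProOn.eq_one_of_pow_eq_one`, `IsFreeProOn.torsionFree`, `IsFreeProOn.torsionFree_subgroup`
  — free pro-`Σ` groups of finite rank ([AbsTopI] Lem 4.5 (i) vocabulary) and all their subgroups are
  torsion-free, in the `IsOfFinOrder` shape of `NonProperIffFree`.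

PROOF (componentwise, as in the `Σ = Primes` file; no cohomological dimension).  Reduce to a prime
exponent `q`.  If `q ∉ Σ`: in every finite quotient `P/N` (a `Σ`-group) the order of `z̄` divides `q`
and `[P : N]`, so it is `1`; hence `z ∈ ⋂ N = 1`.  If `q ∈ Σ`: fix an open normal `U₀ ⊴ P`, `a := z U₀`
of order `c` (a divisor of the `Σ`-integer `[P : U₀]`); the preimage `H̄ ⊇ U₀` of `⟨a⟩` is open, `z ∈ H̄`,
and `H := ι⁻¹H̄ ⊆ Γ` is FREE (Nielsen–Schreier) with `ι| : H → H̄` again a pro-`Σ` completion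
(abc-iut-L5-t9's `restrict`); `θ : H → ⟨a⟩` lifts through `ℤ` (`θ = a^σ`, choose exponents on a free
basis); `K := Ker(H → ℤ → ℤ/qc)` is normal of index dividing the `Σ`-integer `qc`, hence the pull-back
of an open `K̄ ⊆ H̄` (`comap_surj`); take an open normal `N ⊴ P` inside `U₀ ∩ K̄` and `f ∈ H` with
`z ∈ ι(f) N` (density); then `ι(f)^q ∈ N ⊆ K̄` gives `f^q ∈ K`, i.e. `qc ∣ q σ(f)`, `c ∣ σ(f)`, and
`a = θ(f) = a^{σ(f)} = 1`: `z ∈ U₀` for every `U₀`, so `z = 1`.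

HONEST FRAMING: classical profinite group theory (Ribes–Zalesskii §3.3–3.4, there via `cd ≤ 1`);
refereed, undisputed; nothing here bears on [IUTchIII] Cor. 3.12; typed ≠ proved elsewhere.
-/

noncomputable section

open Topology

universe u v w

namespace Literature.AnabelianGeometry.SemiGraphs.SemiGraphOfAnabelioids.IsProSigmaCompletion

open Literature.AnabelianGeometry.Anabelioids (IsSigmaInteger)
open Literature.GroupTheory.CombinatorialGroupTheory

variable {Sigma : Set ℕ} {Γ : Type v} [Group Γ] {P : Type u} [Group P] [TopologicalSpace P]
  {ι : Γ →* P}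

/-! ### Generalities -/

/-- In a profinite group an element lying in every open normal subgroup is trivial. [folklore] -/
private theorem eq_one_of_forall_mem_openNormal [IsTopologicalGroup P] [CompactSpace P] [T2Space P]
    [TotallyDisconnectedSpace P] {z : P} (h : ∀ N : OpenNormalSubgroup P, z ∈ (N : Subgroup P)) :
    z = 1 := by
  by_contra hz
  obtain ⟨N, hN⟩ := ProfiniteGrp.exist_openNormalSubgroup_sub_open_nhds_of_one
    (isOpen_compl_singleton (x := z)) (show (1 : P) ∈ ({z}ᶜ : Set P) from fun h1 => hz h1.symm)
  exact hN (h N) rfl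

omit [TopologicalSpace P] in
/-- In a free group, a homomorphism into a cyclic subgroup `⟨a⟩` factors through the integers:
`θ(h) = a ^ σ(h)` for some `σ : H →* ℤ` (choose exponents on a free basis). [folklore] -/
private theorem exists_hom_int_zpow {H : Type w} [Group H] [IsFreeGroup H] (θ : H →* P) (a : P)
    (hθ : ∀ h, θ h ∈ Subgroup.zpowers a) :
    ∃ σ : H →* Multiplicative ℤ, ∀ h, θ h = a ^ Multiplicative.toAdd (σ h) := by
  classical
  have hk : ∀ b : IsFreeGroup.Generators H, ∃ k : ℤ, a ^ k = θ (IsFreeGroup.of b) := fun b =>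
    Subgroup.mem_zpowers_iff.mp (hθ _)
  choose k hk using hk
  refine ⟨IsFreeGroup.lift fun b => Multiplicative.ofAdd (k b), fun h => ?_⟩
  have key : θ = (zpowersHom P a).comp (IsFreeGroup.lift fun b => Multiplicative.ofAdd (k b)) := by
    refine IsFreeGroup.ext_hom (fun b => ?_)
    rw [MonoidHom.comp_apply, IsFreeGroup.lift_of, zpowersHom_apply, toAdd_ofAdd, hk b]
  conv_lhs => rw [key]
  rfl

/-- A prime in `Σ` is a `Σ`-integer. [cite: MochizukiSemiAnbd2006, Def. 2.9(i) p.31] -/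
private theorem isSigmaInteger_of_prime_mem {q : ℕ} (hq : q.Prime) (hqS : q ∈ Sigma) :
    IsSigmaInteger Sigma q := by
  refine ⟨hq.pos, fun p hp hpq => ?_⟩
  obtain rfl : p = q := (Nat.prime_dvd_prime_iff_eq hp hq).mp hpq
  exact hqS

/-! ### Exponent a prime outside `Σ`: nothing is needed about `Γ` -/

/-- In a pro-`Σ` completion `P` (of any group), an element killed by a prime `q ∉ Σ` lies in every open
normal subgroup: its image in the finite `Σ`-group `P/N` has order dividing both `q` and `[P : N]`.
[cite: MochizukiSemiAnbd2006, Ex. 2.10 p.31] -/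
theorem mem_of_pow_eq_one_of_not_mem [IsTopologicalGroup P] [CompactSpace P]
    (hι : IsProSigmaCompletion Sigma ι) {q : ℕ} (hq : q.Prime)
    (hqS : q ∉ Sigma) {z : P} (hz : z ^ q = 1) (N : OpenNormalSubgroup P) : z ∈ (N : Subgroup P) := by
  haveI : (N : Subgroup P).Normal := N.isNormal'
  haveI : Finite (P ⧸ (N : Subgroup P)) := Subgroup.quotient_finite_of_isOpen _ N.isOpen'
  rw [← QuotientGroup.eq_one_iff]
  set a : P ⧸ (N : Subgroup P) := QuotientGroup.mk z
  have hdvdq : orderOf a ∣ q := orderOf_dvd_of_pow_eq_one (by rw [← QuotientGroup.mk_pow, hz]; rfl)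
  rcases (Nat.dvd_prime hq).mp hdvdq with h1 | hq'
  · exact orderOf_eq_one_iff.mp h1
  · exfalso
    have hidx := hι.index_open (N : Subgroup P) N.isNormal' N.isOpen'
    exact hqS (hidx.2 q hq (hq' ▸ orderOf_dvd_natCard a))

/-- In a pro-`Σ` completion `P` (of any group, `P` profinite) an element killed by a prime `q ∉ Σ` is
trivial. [cite: MochizukiSemiAnbd2006, Ex. 2.10 p.31] -/
theorem eq_one_of_pow_eq_one_of_not_mem [IsTopologicalGroup P] [CompactSpace P] [T2Space P]
    [TotallyDisconnectedSpace P] (hι : IsProSigmaCompletion Sigma ι) {q : ℕ} (hq : q.Prime)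
    (hqS : q ∉ Sigma) {z : P} (hz : z ^ q = 1) : z = 1 :=
  eq_one_of_forall_mem_openNormal fun N => mem_of_pow_eq_one_of_not_mem hι hq hqS hz N

/-! ### Exponent a prime in `Σ`: the free-group argument -/

/-- The core step: for `Γ` FREE and `ι : Γ → P` a pro-`Σ` completion (`P` profinite), an element `z`
with `z ^ q = 1`, `q ∈ Σ` prime, lies in every open normal subgroup `U₀`.  (With `a := z U₀` of order
`c`, `H̄ :=` the preimage of `⟨a⟩`, `H := ι⁻¹H̄` free, `θ : H → ⟨a⟩` lifted to `σ : H → ℤ`,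
`K := Ker(H → ℤ/qc)` the pull-back of an open `K̄ ⊆ H̄`, `N ⊴ P` open inside `U₀ ∩ K̄`, and `f ∈ H`
with `z ∈ ι(f)N`: `ι(f)^q ∈ N` forces `c ∣ σ(f)`, so `a = θ(f) = 1`.)
[cite: MochizukiAbsTopI2012, Lemma 4.5 (i) p.54] -/
theorem mem_of_pow_eq_one_of_isFreeGroup [IsFreeGroup Γ] [IsTopologicalGroup P] [CompactSpace P]
    [TotallyDisconnectedSpace P] (hι : IsProSigmaCompletion Sigma ι)
    {q : ℕ} (hq : q.Prime) (hqS : q ∈ Sigma) {z : P} (hz : z ^ q = 1) (U₀ : OpenNormalSubgroup P) :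
    z ∈ (U₀ : Subgroup P) := by
  classical
  set U : Subgroup P := (U₀ : Subgroup P) with hUdef
  haveI hUn : U.Normal := U₀.isNormal'
  have hUo : IsOpen (U : Set P) := U₀.isOpen'
  haveI : Finite (P ⧸ U) := Subgroup.quotient_finite_of_isOpen U hUo
  haveI : DiscreteTopology (P ⧸ U) := QuotientGroup.discreteTopology hUo
  -- `a := z U₀`, of order `c ∣ [P : U₀]`, a `Σ`-integer
  set a : P ⧸ U := QuotientGroup.mk z with hadef
  rw [← QuotientGroup.eq_one_iff]
  change a = 1
  set c : ℕ := orderOf a with hcdef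
  have hcS : IsSigmaInteger Sigma c := (hι.index_open U hUn hUo).of_dvd (orderOf_dvd_natCard a)
  have hqcS : IsSigmaInteger Sigma (q * c) := (isSigmaInteger_of_prime_mem hq hqS).mul hcS
  -- `H̄ :=` preimage of `⟨a⟩`: open, `⊇ U`, `∋ z`
  set Hbar : Subgroup P := (Subgroup.zpowers a).comap (QuotientGroup.mk' U) with hHbar
  have hUH : U ≤ Hbar := fun u hu => by
    change (QuotientGroup.mk' U) u ∈ Subgroup.zpowers a
    rw [QuotientGroup.mk'_apply, (QuotientGroup.eq_one_iff u).mpr hu]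
    exact one_mem _
  have hHo : IsOpen (Hbar : Set P) := by
    change IsOpen ((QuotientGroup.mk' U) ⁻¹' (Subgroup.zpowers a : Set (P ⧸ U)))
    exact (isOpen_discrete _).preimage QuotientGroup.continuous_mk
  have hzH : z ∈ Hbar := Subgroup.mem_zpowers a
  -- `H := ι⁻¹ H̄` is free; `ι| : H → H̄` is a pro-`Σ` completion
  haveI : CompactSpace Hbar := isCompact_iff_compactSpace.mp (Hbar.isClosed_of_isOpen hHo).isCompact
  have hres : IsProSigmaCompletion Sigma (ι.subgroupComap Hbar) := hι.restrict Hbar hHo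
  -- `θ : H → ⟨a⟩` lifts through `ℤ`
  let θ : Hbar.comap ι →* P ⧸ U := (QuotientGroup.mk' U).comp (ι.comp (Hbar.comap ι).subtype)
  have hθapp : ∀ h : Hbar.comap ι, θ h = QuotientGroup.mk (ι h) := fun _ => rfl
  have hθ : ∀ h : Hbar.comap ι, θ h ∈ Subgroup.zpowers a := fun h => h.2
  obtain ⟨σ, hσ⟩ := exists_hom_int_zpow θ a hθ
  -- `K := Ker(H → ℤ → ℤ/qc)`, normal of `Σ`-integer index
  haveI : NeZero (q * c) := ⟨(Nat.mul_pos hq.pos (orderOf_pos a)).ne'⟩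
  let π : Multiplicative ℤ →* Multiplicative (ZMod (q * c)) :=
    (Int.castAddHom (ZMod (q * c))).toMultiplicative
  have hπ : ∀ t : Multiplicative ℤ, π t = Multiplicative.ofAdd ((Multiplicative.toAdd t : ℤ) : ZMod (q * c)) :=
    fun _ => rfl
  let K : Subgroup (Hbar.comap ι) := (π.comp σ).ker
  haveI hKn : K.Normal := MonoidHom.normal_ker _
  have hKS : IsSigmaInteger Sigma K.index := by
    refine hqcS.of_dvd ?_
    have h1 : K.index = Nat.card (π.comp σ).range := Subgroup.index_ker _
    have h2 : Nat.card (π.comp σ).range ∣ Nat.card (Multiplicative (ZMod (q * c))) :=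
      Subgroup.card_subgroup_dvd_card _
    rw [h1]
    simpa [Nat.card_eq_fintype_card, ZMod.card] using h2
  -- `K` is the pull-back of an open `K̄' ⊆ H̄`
  obtain ⟨K', hK'o, hK'⟩ := hres.comap_surj K hKn hKS
  have hKbo : IsOpen ((K'.map Hbar.subtype : Subgroup P) : Set P) := isOpen_map_subtype Hbar hHo K' hK'o
  -- `N ⊴ P` open normal inside `U ∩ K̄`
  obtain ⟨N, hN⟩ := ProfiniteGrp.exist_openNormalSubgroup_sub_open_nhds_of_one (hUo.inter hKbo)
    ⟨U.one_mem, (K'.map Hbar.subtype).one_mem⟩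
  haveI : (N : Subgroup P).Normal := N.isNormal'
  -- `f ∈ Γ` with `z⁻¹ ι(f) ∈ N`; then `f ∈ H` and `θ f = a`
  obtain ⟨f, hf⟩ := hι.exists_mem_coset (N : Subgroup P) N.isOpen' z
  have hfU : z⁻¹ * ι f ∈ U := (hN hf).1
  have hfH : f ∈ Hbar.comap ι := by
    change ι f ∈ Hbar
    have : ι f = z * (z⁻¹ * ι f) := by group
    rw [this]
    exact Hbar.mul_mem hzH (hUH hfU)
  have hθf : θ ⟨f, hfH⟩ = a := by
    rw [hθapp, hadef, eq_comm, QuotientGroup.eq]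
    exact hfU
  -- `ι(f)^q ∈ N ⊆ K̄`, hence `f^q ∈ K`
  have hfqN : ι (f ^ q) ∈ (N : Subgroup P) := by
    rw [← QuotientGroup.eq_one_iff]
    have h1 : (QuotientGroup.mk (ι f) : P ⧸ (N : Subgroup P)) = QuotientGroup.mk z := by
      rw [eq_comm, QuotientGroup.eq]; exact hf
    rw [map_pow, QuotientGroup.mk_pow, h1, ← QuotientGroup.mk_pow, hz, QuotientGroup.mk_one]
  have hfqK : (⟨f, hfH⟩ : Hbar.comap ι) ^ q ∈ K := by
    rw [← hK', Subgroup.mem_comap]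
    obtain ⟨k', hk'K, hk'⟩ := Subgroup.mem_map.mp (hN hfqN).2
    have hk'eq : k' = (ι.subgroupComap Hbar) ((⟨f, hfH⟩ : Hbar.comap ι) ^ q) := by
      apply Subtype.ext
      rw [map_pow]
      change (k' : P) = ((ι.subgroupComap Hbar ⟨f, hfH⟩ : Hbar) : P) ^ q
      rw [MonoidHom.subgroupComap_apply_coe]
      change (Hbar.subtype k') = ι f ^ q
      rw [hk', map_pow]
    rw [← hk'eq]
    exact hk'K
  -- so `qc ∣ q·σ(f)`, `c ∣ σ(f)`, and `a = θ f = a^{σ f} = 1`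
  set s : ℤ := Multiplicative.toAdd (σ ⟨f, hfH⟩) with hsdef
  have hdvd : ((q * c : ℕ) : ℤ) ∣ (q : ℤ) * s := by
    have h1 : π (σ ((⟨f, hfH⟩ : Hbar.comap ι) ^ q)) = 1 := hfqK
    rw [map_pow, hπ, toAdd_pow, ← hsdef] at h1
    have h2 : (((q • s : ℤ) : ZMod (q * c))) = 0 := by
      have := congrArg Multiplicative.toAdd h1
      rwa [toAdd_ofAdd, toAdd_one] at this
    rw [ZMod.intCast_zmod_eq_zero_iff_dvd] at h2
    simpa [nsmul_eq_mul] using h2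
  have hcs : (c : ℤ) ∣ s := by
    have hq0 : (q : ℤ) ≠ 0 := by exact_mod_cast hq.ne_zero
    rw [Nat.cast_mul] at hdvd
    exact (mul_dvd_mul_iff_left hq0).mp hdvd
  have has : a ^ s = 1 := orderOf_dvd_iff_zpow_eq_one.mp (by rw [← hcdef]; exact hcs)
  rw [← hθf, hσ, ← hsdef, has]

/-- **Pro-`Σ` completions of free groups are torsion-free**: for `Γ` free (`IsFreeGroup`, any rank),
`ι : Γ → P` a pro-`Σ` completion with `P` profinite, and `z ^ m = 1` with `m > 0`, one has `z = 1`.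
(Reduce to a prime exponent `q`; `q ∉ Σ`: `eq_one_of_pow_eq_one_of_not_mem`; `q ∈ Σ`:
`mem_of_pow_eq_one_of_isFreeGroup` at every open normal subgroup.)
[cite: MochizukiAbsTopI2012, Lemma 4.5 (i) p.54] -/
theorem eq_one_of_pow_eq_one_of_isFreeGroup [IsFreeGroup Γ] [IsTopologicalGroup P] [CompactSpace P]
    [T2Space P] [TotallyDisconnectedSpace P] (hι : IsProSigmaCompletion Sigma ι)
    {z : P} {m : ℕ} (hm : 0 < m) (hz : z ^ m = 1) : z = 1 := by
  induction m using Nat.strong_induction_on generalizing z with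
  | _ m ih =>
    rcases Nat.lt_or_ge 1 m with h1 | h1
    · obtain ⟨q, hq, hqm⟩ := Nat.exists_prime_and_dvd h1.ne'
      obtain ⟨k, rfl⟩ := hqm
      have hk : 0 < k := Nat.pos_of_mul_pos_left hm
      have hzk : (z ^ k) ^ q = 1 := by rw [← pow_mul, mul_comm]; exact hz
      have hzk1 : z ^ k = 1 := by
        by_cases hqS : q ∈ Sigma
        · exact eq_one_of_forall_mem_openNormal fun N => mem_of_pow_eq_one_of_isFreeGroup hι hq hqS hzk N
        · exact eq_one_of_pow_eq_one_of_not_mem hι hq hqS hzk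
      have hkm : k < q * k := by
        have := hq.two_le
        nlinarith
      exact ih k hkm hk hzk1
    · have hm1 : m = 1 := le_antisymm h1 hm
      subst hm1
      rwa [pow_one] at hz

/-- In a pro-`Σ` completion of a free group (profinite), an element has finite order iff it is trivial.
[cite: MochizukiAbsTopI2012, Lemma 4.5 (i) p.54] -/
theorem isOfFinOrder_iff_of_isFreeGroup [IsFreeGroup Γ] [IsTopologicalGroup P] [CompactSpace P]
    [T2Space P] [TotallyDisconnectedSpace P] (hι : IsProSigmaCompletion Sigma ι) {z : P} :
    IsOfFinOrder z ↔ z = 1 := by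
  refine ⟨fun h => ?_, fun h => h ▸ IsOfFinOrder.one⟩
  obtain ⟨m, hm, hzm⟩ := h.exists_pow_eq_one
  exact eq_one_of_pow_eq_one_of_isFreeGroup hι hm hzm

omit [Group Γ] in
/-- **Pro-`Σ` completions of punctured surface groups `Γ_{g,r}`, `r ≥ 1` (free of rank `2g + r − 1`),
are torsion-free** — the affine models of [SemiAnbd] Ex. 2.10 / [AbsTopI] §2.
[cite: MochizukiSemiAnbd2006, Ex. 2.10 p.31] -/
theorem eq_one_of_pow_eq_one_puncturedSurfaceGroup [IsTopologicalGroup P] [CompactSpace P] [T2Space P]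
    [TotallyDisconnectedSpace P] {g r : ℕ} (hr : 1 ≤ r)
    {ι : PuncturedSurfaceGroup g r →* P} (hι : IsProSigmaCompletion Sigma ι) {z : P} {m : ℕ}
    (hm : 0 < m) (hz : z ^ m = 1) : z = 1 := by
  classical
  obtain ⟨r', rfl⟩ : ∃ r', r = r' + 1 := ⟨r - 1, by omega⟩
  obtain ⟨e⟩ := PuncturedSurfaceGroup.nonempty_mulEquiv_freeGroup g r'
  have hι' : IsProSigmaCompletion Sigma (ι.comp e.symm.toMonoidHom) :=
    hι.of_comp_mulEquiv e.symm (fun _ => rfl)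
  exact eq_one_of_pow_eq_one_of_isFreeGroup hι' hm hz

end Literature.AnabelianGeometry.SemiGraphs.SemiGraphOfAnabelioids.IsProSigmaCompletion

/-! ### The L4 predicate: free pro-`Σ` groups of finite rank are torsion-free -/

namespace Literature.AnabelianGeometry.AbsoluteAnabelian

open Literature.AnabelianGeometry.SemiGraphs.SemiGraphOfAnabelioids

variable {G : Type u} [Group G] [TopologicalSpace G] [IsTopologicalGroup G] [CompactSpace G]
  [T2Space G] [TotallyDisconnectedSpace G]
variable {S : Set ℕ} {n : ℕ} {gens : Fin n → G}

/-- **A free pro-`Σ` group of finite rank is torsion-free**: if the profinite group `G` is free pro-`Σ`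
on `gens : Fin n → G` (`IsFreeProOn`, [AbsTopI] Lem 4.5 (i) vocabulary) and `z ^ m = 1`, `m > 0`, then
`z = 1` — through abc-iut-L4-t15's bridge `IsFreeProOn.isProSigmaCompletion_lift`.
[cite: MochizukiAbsTopI2012, Lemma 4.5 (i) p.54] -/
theorem IsFreeProOn.eq_one_of_pow_eq_one (h : IsFreeProOn G S gens) {z : G} {m : ℕ} (hm : 0 < m)
    (hz : z ^ m = 1) : z = 1 :=
  IsProSigmaCompletion.eq_one_of_pow_eq_one_of_isFreeGroup h.isProSigmaCompletion_lift hm hz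

/-- **Free pro-`Σ` groups of finite rank are torsion-free**, in the `IsOfFinOrder` shape quantified in
`CuspidalData.NonProperIffFree` ("torsion-free pro-`Σ` open subgroup").
[cite: MochizukiAbsTopI2012, Lemma 4.5 (i) p.54] -/
theorem IsFreeProOn.torsionFree (h : IsFreeProOn G S gens) : ∀ g : G, IsOfFinOrder g → g = 1 :=
  fun _ hg => (IsProSigmaCompletion.isOfFinOrder_iff_of_isFreeGroup h.isProSigmaCompletion_lift).mp hg

/-- … and so is every subgroup `U ⊆ G` (the form `∀ g : U, IsOfFinOrder g → g = 1` of
`CuspidalData.NonProperIffFree`). [cite: MochizukiAbsTopI2012, Lemma 4.5 (i) p.54] -/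
theorem IsFreeProOn.torsionFree_subgroup (h : IsFreeProOn G S gens) (U : Subgroup G) :
    ∀ g : U, IsOfFinOrder g → g = 1 := fun g hg =>
  Subtype.ext (h.torsionFree (g : G) (U.subtype.isOfFinOrder hg))

end Literature.AnabelianGeometry.AbsoluteAnabelian

end
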